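import Summits.KontsevichZagierPeriods.Zeta5Search.WellPoisedFaceLinearFormsPF
import HarnessLib

/-!
# ζ(5) search — the face forms ARE linear forms `A·ζ(5) − B` over `ℚ`, part 2 (cell `pub-zeta5`, fam-vwp gen 7)

HONEST FRAMING: systematic search; no irrationality claim unless certified.

LANE NOTE (P2 g3 filing lane, 2026-08-21, announced mechanical split — mathematics VERBATIM): this module is §§4–6 of
fam-vwp gen 7's staged 590-line `WellPoisedFaceLinearForms.lean` (sha256 1e6c5c36…): decay `t·R(t) → 0`, the
constant and the parity of the partial-fraction data, the summation `F = ½ Σ_t R″(t)` as a linear form, the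
denominators, and the theorems `faceF_linearForm`, `faceF_mem`, `faceLambda_mem_ratSpan` with two kernel instances.
§§1–3 and the full overview docstring are in `WellPoisedFaceLinearFormsPF` (imported).  Standard axioms only.
-/

noncomputable section

open Finset Filter Topology

namespace Summit.KontsevichZagierPeriods.Zeta5Search.WellPoisedFaceRate

open Literature.NumberTheory.Transcendental (zetaValue)
open Literature.NumberTheory.Transcendental.BallRivoal (pfEval brickEval IsInt poch harm exists_pf_prod pfEval_add
  pfEval_reflect pf_unique tendsto_mul_pfEval hasSum_one_div_pow_shift isInt_dpow_mul_harm)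
open Summit.KontsevichZagierPeriods.Zeta5Search.PFSteps (linStep subRes trunc pfEval_linStep linStep_of_le
  isInt_linStep pfEval_trunc isInt_trunc trunc_of_le subBlock_eq_brickEval)
open Summit.KontsevichZagierPeriods.Zeta5Search.DualSeriesDenominators (natCast_dvd_lcmUpto)

variable (η₀ : ℕ) (η : Fin 4 → ℕ) (n : ℕ)

/-! ## 4. Decay `t·R(t) → 0`, the constant, the residues, the parity of the data -/

/-- `k·R(k) → 0` along the naturals (file 3's `faceR_decay`: `R(t) ≤ 2h₀³ R(0)/(t+h₀)³` on `t ≥ 0`). -/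
theorem tendsto_mul_faceR (hη : ∀ j, 2 * η j < η₀) :
    Tendsto (fun k : ℕ => (k : ℝ) * faceR η₀ η n k) atTop (𝓝 0) := by
  set h0 : ℝ := ((η₀ * n + 2 : ℕ) : ℝ) with hh0
  set M : ℝ := 2 * h0 ^ 3 * faceR η₀ η n 0 with hM
  have hR0 : 0 < faceR η₀ η n 0 := faceR_pos η₀ η n (by norm_num)
  have h0pos : 0 < h0 := by rw [hh0]; positivity
  have hMnn : 0 ≤ M := by rw [hM]; positivity
  refine tendsto_of_tendsto_of_tendsto_of_le_of_le' tendsto_const_nhds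
    (tendsto_const_div_atTop_nhds_zero_nat M) ?_ ?_
  · filter_upwards with k
    have hk : (-1/2 : ℝ) < (k : ℝ) := by have : (0 : ℝ) ≤ k := Nat.cast_nonneg k; linarith
    exact mul_nonneg (Nat.cast_nonneg k) (faceR_pos η₀ η n hk).le
  · filter_upwards [eventually_ge_atTop 1] with k hk
    have hk' : (1 : ℝ) ≤ (k : ℝ) := by exact_mod_cast hk
    have hdec := faceR_decay η₀ η hη n (Nat.cast_nonneg k : (0 : ℝ) ≤ (k : ℝ))
    have hkh : 0 < (k : ℝ) + h0 := by linarith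
    have hsq : (k : ℝ) ^ 2 ≤ ((k : ℝ) + h0) ^ 3 :=
      calc (k : ℝ) ^ 2 ≤ (k : ℝ) ^ 3 := by nlinarith
        _ ≤ ((k : ℝ) + h0) ^ 3 := by gcongr; linarith
    have hfrac : (k : ℝ) / ((k : ℝ) + h0) ^ 3 ≤ 1 / (k : ℝ) := by
      rw [div_le_div_iff₀ (by positivity) (by positivity)]
      nlinarith
    calc (k : ℝ) * faceR η₀ η n k
        ≤ (k : ℝ) * (2 * h0 ^ 3 / ((k : ℝ) + h0) ^ 3 * faceR η₀ η n 0) :=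
          mul_le_mul_of_nonneg_left hdec (Nat.cast_nonneg k)
      _ = M * ((k : ℝ) / ((k : ℝ) + h0) ^ 3) := by rw [hM]; field_simp
      _ ≤ M * (1 / (k : ℝ)) := mul_le_mul_of_nonneg_left hfrac hMnn
      _ = M / (k : ℝ) := by rw [mul_one_div]

/-- `R(k) → 0` along the naturals. -/
theorem tendsto_faceR (hη : ∀ j, 2 * η j < η₀) :
    Tendsto (fun k : ℕ => faceR η₀ η n k) atTop (𝓝 0) := by
  have h := (tendsto_mul_faceR η₀ η n hη).div_atTop tendsto_natCast_atTop_atTop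
  refine h.congr' ?_
  filter_upwards [eventually_ge_atTop 1] with k hk
  have hk' : (k : ℝ) ≠ 0 := by positivity
  field_simp

section Data

variable {η₀ η n}
variable (hη : ∀ j, 2 * η j < η₀) {c : ℕ → ℕ → ℚ} {C : ℚ}
  (hc : ∀ t : ℚ, (∀ p, p ≤ η₀ * n → t + p + 1 ≠ 0) → faceRQ η₀ η n t = pfEval (η₀ * n) 4 c t + C)
include hη hc

omit hη hc in
/-- Naturals are away from the poles. -/
theorem natCast_good (k : ℕ) : ∀ p, p ≤ η₀ * n → (k : ℚ) + p + 1 ≠ 0 := fun p _ => by positivity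

omit hη in
/-- `faceR k` is the cast of `pfEval … k + C` at a natural `k`. -/
theorem faceR_natCast (k : ℕ) : faceR η₀ η n k = (pfEval (η₀ * n) 4 c k : ℝ) + (C : ℝ) := by
  have e := hc k (natCast_good k)
  have : faceR η₀ η n (k : ℝ) = ((faceRQ η₀ η n k : ℚ) : ℝ) := by rw [cast_faceRQ]; push_cast; rfl
  rw [this, e]
  push_cast
  rfl

/-- **The constant vanishes**: `C = 0` (both `R(k)` and the partial fractions tend to `0`). -/
theorem const_eq_zero : C = 0 := by
  have h1 : Tendsto (fun k : ℕ => faceR η₀ η n k - (pfEval (η₀ * n) 4 c k : ℝ)) atTop (𝓝 (0 - 0)) :=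
    (tendsto_faceR η₀ η n hη).sub (WedgeDictionary.pfEval_tendsto_zero (η₀ * n) 4 c)
  rw [sub_zero] at h1
  have h2 : Tendsto (fun _ : ℕ => (C : ℝ)) atTop (𝓝 0) := by
    refine h1.congr fun k => ?_
    rw [faceR_natCast hc k]
    ring
  have := tendsto_nhds_unique h2 tendsto_const_nhds
  exact_mod_cast this.symm

/-- **The residues sum to zero** (`⇒` no `ζ(3)`): `Σ_p c_{0,p} = 0`, because `k·R(k) → 0` while
`k·Σ c_{o,p}/(k+p+1)^{o+1} → Σ_p c_{0,p}`. [Zudilin2004, proof of Lemma 19: "R(t) = O(t⁻²)"] -/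
theorem sum_order_zero : ∑ p ∈ range (η₀ * n + 1), c 0 p = 0 := by
  have hC := const_eq_zero hη hc
  have h1 := tendsto_mul_pfEval (η₀ * n) 4 c
  have h2 : Tendsto (fun k : ℕ => (k : ℝ) * (pfEval (η₀ * n) 4 c k : ℝ)) atTop (𝓝 0) := by
    refine (tendsto_mul_faceR η₀ η n hη).congr fun k => ?_
    rw [faceR_natCast hc k, hC]
    push_cast
    ring
  have h3 := tendsto_nhds_unique h1 h2
  have h4 : ∀ p, ∑ o ∈ range 4, (c o p : ℝ) * (0 : ℝ) ^ o = c 0 p := fun p => by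
    simp [Finset.sum_range_succ]
  simp only [h4] at h3
  exact_mod_cast h3

/-- **Parity of the data** from the reflection: `c_{o, N−p} = (−1)^o c_{o,p}` (`N = η₀ n`). -/
theorem data_reflect (o p : ℕ) (ho : o < 4) (hp : p ≤ η₀ * n) :
    c o (η₀ * n - p) = (-1) ^ o * c o p := by
  have hC := const_eq_zero hη hc
  set f : ℕ → ℕ → ℚ := fun o p => (-1) ^ (o + 1) * c o (η₀ * n - p) with hf
  have he : ∀ k : ℕ, 0 ≤ k → pfEval (η₀ * n) 4 (f + c) k = 0 := by
    intro k _
    have hgood1 := natCast_good (η₀ := η₀) (n := n) k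
    have hgood2 : ∀ p, p ≤ η₀ * n → (-(k : ℚ) - ((η₀ * n : ℕ) : ℚ) - 2) + p + 1 ≠ 0 := by
      intro p hp h0
      have hp' : (p : ℚ) ≤ ((η₀ * n : ℕ) : ℚ) := by exact_mod_cast hp
      have hk : (0 : ℚ) ≤ k := by positivity
      linarith
    have e1 := hc _ hgood2
    have e2 := hc _ hgood1
    rw [hC, add_zero] at e1 e2
    have e3 := faceRQ_reflect η₀ η n hη (k : ℚ)
    rw [pfEval_add, hf, pfEval_reflect]
    linarith
  have hz := pf_unique (η₀ * n) 4 (f + c) 0 (fun k _ => he k (Nat.zero_le k)) o p ho hp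
  simp only [Pi.add_apply, hf] at hz
  have hsq : ((-1 : ℚ) ^ (o + 1)) * (-1) ^ (o + 1) = 1 := by
    rw [← pow_add, ← two_mul]
    exact Even.neg_one_pow ⟨o + 1, by ring⟩
  have h1 : (-1 : ℚ) ^ (o + 1) * c o (η₀ * n - p) = -c o p := by linarith
  calc c o (η₀ * n - p) = ((-1 : ℚ) ^ (o + 1) * (-1) ^ (o + 1)) * c o (η₀ * n - p) := by rw [hsq, one_mul]
    _ = (-1) ^ (o + 1) * (-c o p) := by rw [mul_assoc, h1]
    _ = (-1) ^ o * c o p := by rw [pow_succ]; ring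

/-- **Odd orders cancel** (`⇒` no `ζ(4)`, no `ζ(6)`): `Σ_p c_{o,p} = 0` for `o = 1, 3`. -/
theorem sum_odd_order (o : ℕ) (ho : o < 4) (hodd : Odd o) : ∑ p ∈ range (η₀ * n + 1), c o p = 0 := by
  have hrefl : ∑ p ∈ range (η₀ * n + 1), c o p = ∑ p ∈ range (η₀ * n + 1), c o (η₀ * n - p) := by
    rw [← sum_range_reflect (fun p => c o p) (η₀ * n + 1)]
    refine sum_congr rfl fun p _ => ?_
    show c o (η₀ * n + 1 - 1 - p) = c o (η₀ * n - p)
    rw [Nat.add_sub_cancel]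
  have hneg : ∀ p ∈ range (η₀ * n + 1), c o (η₀ * n - p) = -c o p := fun p hp => by
    rw [data_reflect hη hc o p ho (by have := mem_range.1 hp; omega), hodd.neg_one_pow]
    ring
  rw [sum_congr rfl hneg, sum_neg_distrib] at hrefl
  linarith

/-! ## 5. Summation: `F = ½ Σ_t R″(t)` as a linear form -/

/-- `R″(t)` at a natural `t`, through the partial fractions. -/
theorem iteratedDeriv_two_faceR_eq (t : ℕ) :
    iteratedDeriv 2 (faceR η₀ η n) (t : ℝ) = ∑ p ∈ range (η₀ * n + 1), ∑ o ∈ range 4,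
      (c o p : ℝ) * ((((o + 1 : ℕ) : ℝ) * ((o + 1 : ℕ) + 1)) *
        (((t : ℝ) + ((p + 1 : ℕ) : ℝ)) ^ (o + 1 + 2))⁻¹) := by
  have hC := const_eq_zero hη hc
  have ht0 : (0 : ℝ) ≤ t := Nat.cast_nonneg t
  have heq : faceR η₀ η n =ᶠ[𝓝 (t : ℝ)] pfR (η₀ * n) c := by
    filter_upwards [Ioi_mem_nhds (show (-1/2 : ℝ) < t by linarith)] with y hy
    have hy' : (-1/2 : ℝ) < y := hy
    rw [faceR_eq_pfR η₀ η n hc hy', hC, Rat.cast_zero, add_zero]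
  rw [heq.iteratedDeriv_eq, iteratedDeriv_two_pfR (η₀ * n) c (by linarith)]

/-- **`Σ_{t ≥ 0} R″(t)` converges to the linear form `Σ_{p,o} c_{o,p}(o+1)(o+2)(ζ(o+3) − H_p^{(o+3)})`.** -/
theorem hasSum_iteratedDeriv_two_faceR :
    HasSum (fun t : ℕ => iteratedDeriv 2 (faceR η₀ η n) (t : ℝ))
      (∑ p ∈ range (η₀ * n + 1), ∑ o ∈ range 4,
        (c o p : ℝ) * ((((o + 1 : ℕ) : ℝ) * ((o + 1 : ℕ) + 1)) *
          (zetaValue (o + 3) - (harm (o + 3) p : ℝ)))) := by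
  have hfun : (fun t : ℕ => iteratedDeriv 2 (faceR η₀ η n) (t : ℝ)) = fun t : ℕ =>
      ∑ p ∈ range (η₀ * n + 1), ∑ o ∈ range 4,
        (c o p : ℝ) * ((((o + 1 : ℕ) : ℝ) * ((o + 1 : ℕ) + 1)) *
          (((t : ℝ) + ((p + 1 : ℕ) : ℝ)) ^ (o + 1 + 2))⁻¹) :=
    funext fun t => iteratedDeriv_two_faceR_eq hη hc t
  rw [hfun]
  refine hasSum_sum fun p _ => hasSum_sum fun o _ => ?_
  refine HasSum.mul_left _ (HasSum.mul_left _ ?_)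
  have h := hasSum_one_div_pow_shift (o + 3) p (by omega)
  have hfun2 : (fun t : ℕ => (((t : ℝ) + ((p + 1 : ℕ) : ℝ)) ^ (o + 1 + 2))⁻¹)
      = fun k : ℕ => 1 / ((k : ℝ) + p + 1) ^ (o + 3) := by
    funext k
    rw [one_div]
    push_cast
    ring
  rw [hfun2]
  exact h

/-- The `ζ(5)`-coefficient `A = 6·Σ_p c_{2,p}` of the data. -/
def coefA (N : ℕ) (c : ℕ → ℕ → ℚ) : ℚ := 6 * ∑ p ∈ range (N + 1), c 2 p

/-- The constant term `B = Σ_p (c_{0,p}H_p^{(3)} + 3c_{1,p}H_p^{(4)} + 6c_{2,p}H_p^{(5)} + 10c_{3,p}H_p^{(6)})`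
(`binom(o+2, 2) = 1, 3, 6, 10`). -/
def coefB (N : ℕ) (c : ℕ → ℕ → ℚ) : ℚ :=
  ∑ p ∈ range (N + 1), (c 0 p * harm 3 p + 3 * (c 1 p * harm 4 p) + 6 * (c 2 p * harm 5 p) + 10 * (c 3 p * harm 6 p))

/-- **`F = A·ζ(5) − B`** for the data of `R`: the `ζ(3)`, `ζ(4)`, `ζ(6)` coefficients `Σ_p c_{0,p}`,
`3Σ_p c_{1,p}`, `10Σ_p c_{3,p}` vanish (`sum_order_zero`, `sum_odd_order`). -/
theorem faceF_eq_coef : faceF η₀ η n = (coefA (η₀ * n) c : ℝ) * zetaValue 5 - (coefB (η₀ * n) c : ℝ) := by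
  have h0 : ∑ p ∈ range (η₀ * n + 1), (c 0 p : ℝ) = 0 := by exact_mod_cast sum_order_zero hη hc
  have h1 : ∑ p ∈ range (η₀ * n + 1), (c 1 p : ℝ) = 0 := by
    exact_mod_cast sum_odd_order hη hc 1 (by norm_num) ⟨0, rfl⟩
  have h3 : ∑ p ∈ range (η₀ * n + 1), (c 3 p : ℝ) = 0 := by
    exact_mod_cast sum_odd_order hη hc 3 (by norm_num) ⟨1, rfl⟩
  unfold faceF
  rw [(hasSum_iteratedDeriv_two_faceR hη hc).tsum_eq, mul_sum]
  have hE : ∀ p ∈ range (η₀ * n + 1),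
      (1 / 2 : ℝ) * ∑ o ∈ range 4, (c o p : ℝ) * ((((o + 1 : ℕ) : ℝ) * ((o + 1 : ℕ) + 1)) *
          (zetaValue (o + 3) - (harm (o + 3) p : ℝ)))
        = (6 * zetaValue 5 * (c 2 p : ℝ)
            - ((c 0 p : ℝ) * harm 3 p + 3 * ((c 1 p : ℝ) * harm 4 p) + 6 * ((c 2 p : ℝ) * harm 5 p)
                + 10 * ((c 3 p : ℝ) * harm 6 p)))
          + (zetaValue 3 * (c 0 p : ℝ) + 3 * zetaValue 4 * (c 1 p : ℝ) + 10 * zetaValue 6 * (c 3 p : ℝ)) := by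
    intro p _
    simp only [sum_range_succ, sum_range_zero]
    push_cast
    ring
  have hvan : ∑ p ∈ range (η₀ * n + 1),
      (zetaValue 3 * (c 0 p : ℝ) + 3 * zetaValue 4 * (c 1 p : ℝ) + 10 * zetaValue 6 * (c 3 p : ℝ)) = 0 := by
    rw [sum_add_distrib, sum_add_distrib, ← mul_sum, ← mul_sum, ← mul_sum, h0, h1, h3]
    ring
  rw [sum_congr rfl hE, sum_add_distrib, hvan, add_zero, sum_sub_distrib, ← mul_sum]
  unfold coefA coefB
  push_cast
  ring

end Data

/-! ## 6. Denominators and the theorems -/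

/-- A finite sum of rationals that are integers is an integer. -/
theorem exists_int_sum (s : Finset ℕ) (f : ℕ → ℚ) (h : ∀ p ∈ s, ∃ z : ℤ, f p = z) :
    ∃ z : ℤ, ∑ p ∈ s, f p = z := by
  classical
  induction s using Finset.induction_on with
  | empty => exact ⟨0, by simp⟩
  | insert a s ha ih =>
    obtain ⟨z, hz⟩ := h a (mem_insert_self a s)
    obtain ⟨w, hw⟩ := ih fun p hp => h p (mem_insert_of_mem hp)
    exact ⟨z + w, by rw [sum_insert ha, hz, hw]; push_cast; ring⟩

/-- `d·A ∈ ℤ` for data with `d^{3−o} c_{o,p} ∈ ℤ`. -/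
theorem coefA_den (N d : ℕ) (c : ℕ → ℕ → ℚ) (hint : IsInt 4 d c) :
    ∃ z : ℤ, (d : ℚ) * coefA N c = z := by
  have h : ∀ p ∈ range (N + 1), ∃ z : ℤ, 6 * ((d : ℚ) * c 2 p) = z := by
    intro p _
    obtain ⟨z, hz⟩ := hint 2 p
    refine ⟨6 * z, ?_⟩
    norm_num at hz
    rw [hz]
    push_cast
    ring
  obtain ⟨z, hz⟩ := exists_int_sum _ _ h
  refine ⟨z, ?_⟩
  rw [← hz, coefA, ← mul_assoc, mul_comm (d : ℚ) 6, mul_assoc, mul_sum, mul_sum]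

/-- `d⁶·B ∈ ℤ` for data with `d^{3−o} c_{o,p} ∈ ℤ` and `d` a common multiple of `1, …, N`
(`d^{3−o} c_{o,p} · d^{o+3} H_p^{(o+3)}`). -/
theorem coefB_den (N d : ℕ) (hdiv : ∀ k : ℕ, 1 ≤ k → k ≤ N → (k : ℤ) ∣ d) (c : ℕ → ℕ → ℚ)
    (hint : IsInt 4 d c) : ∃ z : ℤ, (d : ℚ) ^ 6 * coefB N c = z := by
  have h : ∀ p ∈ range (N + 1), ∃ z : ℤ, (d : ℚ) ^ 6 *
      (c 0 p * harm 3 p + 3 * (c 1 p * harm 4 p) + 6 * (c 2 p * harm 5 p) + 10 * (c 3 p * harm 6 p)) = z := by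
    intro p hp
    have hp' : p ≤ N := by have := mem_range.1 hp; omega
    obtain ⟨z0, hz0⟩ := hint 0 p
    obtain ⟨z1, hz1⟩ := hint 1 p
    obtain ⟨z2, hz2⟩ := hint 2 p
    obtain ⟨z3, hz3⟩ := hint 3 p
    obtain ⟨w3, hw3⟩ := isInt_dpow_mul_harm N d hdiv 3 p hp'
    obtain ⟨w4, hw4⟩ := isInt_dpow_mul_harm N d hdiv 4 p hp'
    obtain ⟨w5, hw5⟩ := isInt_dpow_mul_harm N d hdiv 5 p hp'
    obtain ⟨w6, hw6⟩ := isInt_dpow_mul_harm N d hdiv 6 p hp'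
    norm_num at hz0 hz1 hz2 hz3
    refine ⟨z0 * w3 + 3 * (z1 * w4) + 6 * (z2 * w5) + 10 * (z3 * w6), ?_⟩
    push_cast
    rw [← hz0, ← hz1, ← hz2, ← hz3, ← hw3, ← hw4, ← hw5, ← hw6]
    ring
  obtain ⟨z, hz⟩ := exists_int_sum _ _ h
  exact ⟨z, by rw [← hz, coefB, mul_sum]⟩

/-- **THEOREM (the meaning of the face theorem, kernel).**  For every integral face direction (`2η_j < η₀`) and
every `n`, Zudilin's form `F(h_n) = ½ Σ_{t≥0} R″(t)` (file 2's `faceF`) is `A·ζ(5) − B` with `A, B ∈ ℚ`,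
`D_{η₀ n}·A ∈ ℤ` and `D_{η₀ n}⁶·B ∈ ℤ` — a linear form in `1` and `ζ(5)` ALONE (no `ζ(3)`, `ζ(4)`, `ζ(6)`).
[Zudilin2004, Lemma 19] proves the sharper `D_{M₁}³D_{M₂}D_{M₃}D_{M₄}Φ⁻¹F ∈ ℤζ(5) + ℤ`; that refinement of the
DENOMINATOR is not formalised here. -/
theorem faceF_linearForm (hη : ∀ j, 2 * η j < η₀) :
    ∃ A B : ℚ, faceF η₀ η n = (A : ℝ) * zetaValue 5 - (B : ℝ) ∧
      (∃ z : ℤ, (Nat.lcmUpto (η₀ * n) : ℚ) * A = z) ∧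
      (∃ z : ℤ, (Nat.lcmUpto (η₀ * n) : ℚ) ^ 6 * B = z) := by
  obtain ⟨c, hint, C, hc⟩ := exists_faceData η₀ η n hη
  exact ⟨coefA (η₀ * n) c, coefB (η₀ * n) c, faceF_eq_coef hη hc, coefA_den _ _ c hint,
    coefB_den _ _ (fun k hk1 hk2 => natCast_dvd_lcmUpto hk1 hk2) c hint⟩

/-- **COROLLARY.** `D_{η₀ n}⁶ · F(h_n) ∈ ℤ·ζ(5) + ℤ` on every integral face direction, every `n`. -/
theorem faceF_mem (hη : ∀ j, 2 * η j < η₀) :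
    ∃ a b : ℤ, ((Nat.lcmUpto (η₀ * n) : ℝ)) ^ 6 * faceF η₀ η n = (a : ℝ) * zetaValue 5 - (b : ℝ) := by
  obtain ⟨A, B, hF, ⟨za, hza⟩, ⟨zb, hzb⟩⟩ := faceF_linearForm η₀ η n hη
  refine ⟨(Nat.lcmUpto (η₀ * n) : ℤ) ^ 5 * za, zb, ?_⟩
  have ea : ((Nat.lcmUpto (η₀ * n) : ℝ)) * (A : ℝ) = (za : ℝ) := by
    have := congrArg (fun q : ℚ => (q : ℝ)) hza
    push_cast at this
    exact this
  have eb : ((Nat.lcmUpto (η₀ * n) : ℝ)) ^ 6 * (B : ℝ) = (zb : ℝ) := by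
    have := congrArg (fun q : ℚ => (q : ℝ)) hzb
    push_cast at this
    exact this
  rw [hF, mul_sub, eb]
  push_cast
  rw [← ea]
  ring

/-- **COROLLARY.** The normalised face forms `Λ_n = D_{M₁}³D_{M₂}D_{M₃}D_{M₄}·Φ⁻¹·F_n` of file 5 (`faceLambda`,
which tend to `+∞` by `faceLambda_tendsto_atTop`) lie in `ℚ·ζ(5) + ℚ` (kernel); [Zudilin2004, Lemma 19] places
them in `ℤ·ζ(5) + ℤ` (printed). Either way they prove nothing about `ζ(5)`. -/
theorem faceLambda_mem_ratSpan (hη : ∀ j, 2 * η j < η₀) :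
    ∃ u v : ℚ, faceLambda η₀ η n = (u : ℝ) * zetaValue 5 - (v : ℝ) := by
  obtain ⟨A, B, hF, -, -⟩ := faceF_linearForm η₀ η n hη
  refine ⟨((Nat.lcmUpto (faceMZ η₀ η n 0).toNat : ℚ) ^ 3 * Nat.lcmUpto (faceMZ η₀ η n 1).toNat
      * Nat.lcmUpto (faceMZ η₀ η n 2).toNat * Nat.lcmUpto (faceMZ η₀ η n 3).toNat)
      / (facePhi η₀ η n : ℚ) * A,
    ((Nat.lcmUpto (faceMZ η₀ η n 0).toNat : ℚ) ^ 3 * Nat.lcmUpto (faceMZ η₀ η n 1).toNat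
      * Nat.lcmUpto (faceMZ η₀ η n 2).toNat * Nat.lcmUpto (faceMZ η₀ η n 3).toNat)
      / (facePhi η₀ η n : ℚ) * B, ?_⟩
  rw [faceLambda, hF]
  push_cast
  ring

/-- Kernel instance: the classical symmetric pure-pole `ζ(5)` series, direction `(3; 0³, 1⁴)`:
`D_{3n}⁶ F_n ∈ ℤζ(5) + ℤ` for every `n`. -/
example (n : ℕ) : ∃ a b : ℤ,
    ((Nat.lcmUpto (3 * n) : ℝ)) ^ 6 * faceF 3 ![1, 1, 1, 1] n = (a : ℝ) * zetaValue 5 - (b : ℝ) :=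
  faceF_mem 3 ![1, 1, 1, 1] n (by decide)

/-- Kernel instance: the MODEL face maximiser shape `(14; 0³, 4,4,5,5)` of FAMILY.md §13. -/
example (n : ℕ) : ∃ a b : ℤ,
    ((Nat.lcmUpto (14 * n) : ℝ)) ^ 6 * faceF 14 ![4, 4, 5, 5] n = (a : ℝ) * zetaValue 5 - (b : ℝ) :=
  faceF_mem 14 ![4, 4, 5, 5] n (by decide)


end Summit.KontsevichZagierPeriods.Zeta5Search.WellPoisedFaceRate
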